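import Literature.Probability.Percolation.KSTPeriodicStatements
import HarnessLib

/-!
# KST-type RSW for periodic measures: planar topology of lattice walks, I

Topic `Literature/Probability/Percolation`. Discharge of the folklore planar-topology statements of
`KSTPeriodicStatements.lean` (the topological input of the weak periodic
Köhler-Schindler–Tassion RSW theorem [KohlerSchindlerTassion2023]): this file proves
`TopSideToLeftMeetsTB` and `TopSideToRightMeetsTB` and sets up the common machinery; the companion
file `KSTPeriodicTopologyII.lean` proves `AlternatingTBMeet`, `PartsMeetMPath`,
`PartsToSegmentsMeet` and `ArchesMeet` with it.

All six facts say that two lattice walks in a box of `ℤ²` with suitably interleaved endpoints on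
its boundary have a common vertex, and all are reduced to the one discrete Jordan-curve statement
of the library, `exists_mem_support_of_crossing` (`PlanarDuality.lean`: a left–right and a
top–bottom crossing walk of a rectangle meet; Kesten 1982, §2.2; Bollobás–Riordan 2006, Ch. 3), as
follows. Each of the two walks is extended *outside* the box by straight runs (one or two lattice
steps away from the boundary) so that one extension joins the left and right columns of a box
larger by one or two layers and the other joins its top and bottom rows; a common vertex of the
extensions is then a common vertex of the original walks, because the added runs meet the old box
only in the endpoints they are attached to and are pairwise disjoint outside it (or, in
`PartsMeetMPath`, intersect only when two endpoints coincide).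

## Contents

* straight runs and hooks: `exists_rowWalk`, `exists_colWalk`, `exists_hookWalk_hv`,
  `exists_hookWalk_vh`, `exists_hookWalk_from_vh`, `exists_hookWalk_from_hv` (walks along a row /
  a column / an `L`-shaped hook, with the obvious bound on their vertices; the far endpoint is
  produced existentially with its two coordinates, so no explicit vectors are ever needed);
* the reduction lemma `meet_of_extensions`;
* `topSideToLeftMeetsTB : TopSideToLeftMeetsTB`, `topSideToRightMeetsTB : TopSideToRightMeetsTB`.

Design: no definitions; every geometric side condition is a linear-arithmetic statement about the
two coordinates and is discharged by `omega`.

## References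

* H. Kesten, *Percolation theory for mathematicians*, Birkhäuser (1982), §2.2.
* B. Bollobás, O. Riordan, *Percolation*, Cambridge Univ. Press (2006), Ch. 3.
* [KohlerSchindlerTassion2023] L. Köhler-Schindler, V. Tassion, *Crossing probabilities for planar
  percolation*, Duke Math. J. 172 (2023) 809–838, §3–§5 (where these facts are used).
-/

namespace Literature.Probability.Percolation

open SimpleGraph LatticeModels

noncomputable section

namespace KSTPeriodic

/-! ### Straight runs and hooks -/

/-- A walk along a row, rightwards: from `x` to the point `n` steps to its right. [folklore] -/
theorem exists_rowWalk_add (n : ℕ) : ∀ (x y : Site 2), x 1 = y 1 → y 0 = x 0 + n →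
    ∃ W : (zdGraph 2).Walk x y, ∀ z ∈ W.support, z 1 = x 1 ∧ x 0 ≤ z 0 ∧ z 0 ≤ y 0 := by
  induction n with
  | zero =>
    intro x y h1 h0
    obtain rfl : x = y := Site.eq_iff_two.2 ⟨by omega, h1⟩
    exact ⟨Walk.nil, fun z hz => by rw [Walk.support_nil, List.mem_singleton] at hz; subst hz; omega⟩
  | succ n ih =>
    intro x y h1 h0
    have hadj : (zdGraph 2).Adj x (x + Pi.single 0 1) := adj_of_stepKind (.right (by simp) (by simp))
    obtain ⟨W, hW⟩ := ih (x + Pi.single 0 1) y (by simpa using h1) (by simp; omega)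
    refine ⟨Walk.cons hadj W, fun z hz => ?_⟩
    rw [Walk.support_cons, List.mem_cons] at hz
    rcases hz with rfl | hz
    · omega
    · have := hW z hz
      simp at this
      omega

/-- A walk along a row between two points of the row, staying between them. [folklore] -/
theorem exists_rowWalk (x y : Site 2) (h : x 1 = y 1) :
    ∃ W : (zdGraph 2).Walk x y, ∀ z ∈ W.support,
      z 1 = x 1 ∧ ((x 0 ≤ z 0 ∧ z 0 ≤ y 0) ∨ (y 0 ≤ z 0 ∧ z 0 ≤ x 0)) := by
  rcases le_total (x 0) (y 0) with hle | hle
  · obtain ⟨W, hW⟩ := exists_rowWalk_add (y 0 - x 0).toNat x y h (by omega)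
    exact ⟨W, fun z hz => ⟨(hW z hz).1, Or.inl (hW z hz).2⟩⟩
  · obtain ⟨W, hW⟩ := exists_rowWalk_add (x 0 - y 0).toNat y x h.symm (by omega)
    refine ⟨W.reverse, fun z hz => ?_⟩
    rw [Walk.support_reverse, List.mem_reverse] at hz
    have := hW z hz
    omega

/-- A walk along a column, upwards: from `x` to the point `n` steps above it. [folklore] -/
theorem exists_colWalk_add (n : ℕ) : ∀ (x y : Site 2), x 0 = y 0 → y 1 = x 1 + n →
    ∃ W : (zdGraph 2).Walk x y, ∀ z ∈ W.support, z 0 = x 0 ∧ x 1 ≤ z 1 ∧ z 1 ≤ y 1 := by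
  induction n with
  | zero =>
    intro x y h0 h1
    obtain rfl : x = y := Site.eq_iff_two.2 ⟨h0, by omega⟩
    exact ⟨Walk.nil, fun z hz => by rw [Walk.support_nil, List.mem_singleton] at hz; subst hz; omega⟩
  | succ n ih =>
    intro x y h0 h1
    have hadj : (zdGraph 2).Adj x (x + Pi.single 1 1) := adj_of_stepKind (.up (by simp) (by simp))
    obtain ⟨W, hW⟩ := ih (x + Pi.single 1 1) y (by simpa using h0) (by simp; omega)
    refine ⟨Walk.cons hadj W, fun z hz => ?_⟩
    rw [Walk.support_cons, List.mem_cons] at hz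
    rcases hz with rfl | hz
    · omega
    · have := hW z hz
      simp at this
      omega

/-- A walk along a column between two points of the column, staying between them. [folklore] -/
theorem exists_colWalk (x y : Site 2) (h : x 0 = y 0) :
    ∃ W : (zdGraph 2).Walk x y, ∀ z ∈ W.support,
      z 0 = x 0 ∧ ((x 1 ≤ z 1 ∧ z 1 ≤ y 1) ∨ (y 1 ≤ z 1 ∧ z 1 ≤ x 1)) := by
  rcases le_total (x 1) (y 1) with hle | hle
  · obtain ⟨W, hW⟩ := exists_colWalk_add (y 1 - x 1).toNat x y h (by omega)
    exact ⟨W, fun z hz => ⟨(hW z hz).1, Or.inl (hW z hz).2⟩⟩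
  · obtain ⟨W, hW⟩ := exists_colWalk_add (x 1 - y 1).toNat y x h.symm (by omega)
    refine ⟨W.reverse, fun z hz => ?_⟩
    rw [Walk.support_reverse, List.mem_reverse] at hz
    have := hW z hz
    omega

/-- **Hook walk, horizontal then vertical.** From the point `(a, b)` along the row `b` to the
column of `x`, then along that column to `x`. [folklore] -/
theorem exists_hookWalk_hv (a b : ℤ) (x : Site 2) :
    ∃ (y : Site 2) (W : (zdGraph 2).Walk y x), y 0 = a ∧ y 1 = b ∧ ∀ z ∈ W.support,
      (z 1 = b ∧ ((a ≤ z 0 ∧ z 0 ≤ x 0) ∨ (x 0 ≤ z 0 ∧ z 0 ≤ a))) ∨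
      (z 0 = x 0 ∧ ((b ≤ z 1 ∧ z 1 ≤ x 1) ∨ (x 1 ≤ z 1 ∧ z 1 ≤ b))) := by
  obtain ⟨W₁, hW₁⟩ := exists_rowWalk ![a, b] ![x 0, b] (by simp)
  obtain ⟨W₂, hW₂⟩ := exists_colWalk ![x 0, b] x (by simp)
  refine ⟨![a, b], W₁.append W₂, by simp, by simp, fun z hz => ?_⟩
  rw [Walk.mem_support_append_iff] at hz
  rcases hz with hz | hz
  · have := hW₁ z hz
    simp at this
    omega
  · have := hW₂ z hz
    simp at this
    omega

/-- **Hook walk, vertical then horizontal.** From the point `(a, b)` along the column `a` to the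
row of `x`, then along that row to `x`. [folklore] -/
theorem exists_hookWalk_vh (a b : ℤ) (x : Site 2) :
    ∃ (y : Site 2) (W : (zdGraph 2).Walk y x), y 0 = a ∧ y 1 = b ∧ ∀ z ∈ W.support,
      (z 0 = a ∧ ((b ≤ z 1 ∧ z 1 ≤ x 1) ∨ (x 1 ≤ z 1 ∧ z 1 ≤ b))) ∨
      (z 1 = x 1 ∧ ((a ≤ z 0 ∧ z 0 ≤ x 0) ∨ (x 0 ≤ z 0 ∧ z 0 ≤ a))) := by
  obtain ⟨W₁, hW₁⟩ := exists_colWalk ![a, b] ![a, x 1] (by simp)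
  obtain ⟨W₂, hW₂⟩ := exists_rowWalk ![a, x 1] x (by simp)
  refine ⟨![a, b], W₁.append W₂, by simp, by simp, fun z hz => ?_⟩
  rw [Walk.mem_support_append_iff] at hz
  rcases hz with hz | hz
  · have := hW₁ z hz
    simp at this
    omega
  · have := hW₂ z hz
    simp at this
    omega

/-- Hook walk *from* `x`: along the column of `x` to the row `b`, then along that row to
`(a, b)`. [folklore] -/
theorem exists_hookWalk_from_vh (x : Site 2) (a b : ℤ) :
    ∃ (y : Site 2) (W : (zdGraph 2).Walk x y), y 0 = a ∧ y 1 = b ∧ ∀ z ∈ W.support,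
      (z 1 = b ∧ ((a ≤ z 0 ∧ z 0 ≤ x 0) ∨ (x 0 ≤ z 0 ∧ z 0 ≤ a))) ∨
      (z 0 = x 0 ∧ ((b ≤ z 1 ∧ z 1 ≤ x 1) ∨ (x 1 ≤ z 1 ∧ z 1 ≤ b))) := by
  obtain ⟨y, W, h0, h1, hW⟩ := exists_hookWalk_hv a b x
  refine ⟨y, W.reverse, h0, h1, fun z hz => hW z ?_⟩
  rwa [Walk.support_reverse, List.mem_reverse] at hz

/-- Hook walk *from* `x`: along the row of `x` to the column `a`, then along that column to
`(a, b)`. [folklore] -/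
theorem exists_hookWalk_from_hv (x : Site 2) (a b : ℤ) :
    ∃ (y : Site 2) (W : (zdGraph 2).Walk x y), y 0 = a ∧ y 1 = b ∧ ∀ z ∈ W.support,
      (z 0 = a ∧ ((b ≤ z 1 ∧ z 1 ≤ x 1) ∨ (x 1 ≤ z 1 ∧ z 1 ≤ b))) ∨
      (z 1 = x 1 ∧ ((a ≤ z 0 ∧ z 0 ≤ x 0) ∨ (x 0 ≤ z 0 ∧ z 0 ≤ a))) := by
  obtain ⟨y, W, h0, h1, hW⟩ := exists_hookWalk_vh a b x
  refine ⟨y, W.reverse, h0, h1, fun z hz => hW z ?_⟩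
  rwa [Walk.support_reverse, List.mem_reverse] at hz

/-! ### The reduction lemma -/

/-- **Reduction lemma.** Let `P`, `Q` be walks in the box `[L, R] × [B, T]` and `P'`, `Q'` walks
whose vertices are vertices of `P` (resp. `Q`) or lie in sets `SP` (resp. `SQ`) contained in a
bigger box `[L', R'] × [B', T']`, such that `SP` meets the small box only in vertices of `P`,
`SQ` only in vertices of `Q`, and `SP ∩ SQ` lies in the small box unless `P` and `Q` already
meet. If `P'` joins the left and right columns of the big box and `Q'` its top and bottom rows,
then `P` and `Q` have a common vertex (by `exists_mem_support_of_crossing`). [folklore] -/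
theorem meet_of_extensions {L R B T L' R' B' T' : ℤ} {p q u v p' q' u' v' : Site 2}
    (P : (zdGraph 2).Walk p q) (Q : (zdGraph 2).Walk u v)
    (P' : (zdGraph 2).Walk p' q') (Q' : (zdGraph 2).Walk u' v') (SP SQ : Site 2 → Prop)
    (hP : ∀ z ∈ P.support, L ≤ z 0 ∧ z 0 ≤ R ∧ B ≤ z 1 ∧ z 1 ≤ T)
    (hQ : ∀ z ∈ Q.support, L ≤ z 0 ∧ z 0 ≤ R ∧ B ≤ z 1 ∧ z 1 ≤ T)
    (hbox : L' ≤ L ∧ R ≤ R' ∧ B' ≤ B ∧ T ≤ T')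
    (hP' : ∀ z ∈ P'.support, z ∈ P.support ∨ SP z)
    (hQ' : ∀ z ∈ Q'.support, z ∈ Q.support ∨ SQ z)
    (hSP : ∀ z, SP z → L' ≤ z 0 ∧ z 0 ≤ R' ∧ B' ≤ z 1 ∧ z 1 ≤ T')
    (hSQ : ∀ z, SQ z → L' ≤ z 0 ∧ z 0 ≤ R' ∧ B' ≤ z 1 ∧ z 1 ≤ T')
    (h1 : ∀ z, SP z → L ≤ z 0 ∧ z 0 ≤ R ∧ B ≤ z 1 ∧ z 1 ≤ T → z ∈ P.support)
    (h2 : ∀ z, SQ z → L ≤ z 0 ∧ z 0 ≤ R ∧ B ≤ z 1 ∧ z 1 ≤ T → z ∈ Q.support)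
    (h3 : ∀ z, SP z → SQ z → (z 0 < L ∨ R < z 0 ∨ z 1 < B ∨ T < z 1) →
      ∃ w ∈ P.support, w ∈ Q.support)
    (hpq : (p' 0 = L' ∧ q' 0 = R') ∨ (p' 0 = R' ∧ q' 0 = L'))
    (huv : (u' 1 = T' ∧ v' 1 = B') ∨ (u' 1 = B' ∧ v' 1 = T')) :
    ∃ z ∈ P.support, z ∈ Q.support := by
  -- both extended walks lie in the big box
  have hP'box : ∀ z ∈ P'.support, L' ≤ z 0 ∧ z 0 ≤ R' ∧ B' ≤ z 1 ∧ z 1 ≤ T' := by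
    intro z hz
    rcases hP' z hz with hz | hz
    · have := hP z hz; omega
    · exact hSP z hz
  have hQ'box : ∀ z ∈ Q'.support, L' ≤ z 0 ∧ z 0 ≤ R' ∧ B' ≤ z 1 ∧ z 1 ≤ T' := by
    intro z hz
    rcases hQ' z hz with hz | hz
    · have := hQ z hz; omega
    · exact hSQ z hz
  -- a common vertex of the extended walks
  have hmeet : ∃ z ∈ P'.support, z ∈ Q'.support := by
    rcases hpq with ⟨hp', hq'⟩ | ⟨hp', hq'⟩ <;> rcases huv with ⟨hu', hv'⟩ | ⟨hu', hv'⟩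
    · obtain ⟨z, hzP, hzQ⟩ := exists_mem_support_of_crossing P' Q'.reverse hP'box
        (fun z hz => hQ'box z (by rwa [Walk.support_reverse, List.mem_reverse] at hz)) hp' hq' hv' hu'
      exact ⟨z, hzP, by rwa [Walk.support_reverse, List.mem_reverse] at hzQ⟩
    · exact exists_mem_support_of_crossing P' Q' hP'box hQ'box hp' hq' hu' hv'
    · obtain ⟨z, hzP, hzQ⟩ := exists_mem_support_of_crossing P'.reverse Q'.reverse
        (fun z hz => hP'box z (by rwa [Walk.support_reverse, List.mem_reverse] at hz))
        (fun z hz => hQ'box z (by rwa [Walk.support_reverse, List.mem_reverse] at hz)) hq' hp' hv' hu'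
      exact ⟨z, by rwa [Walk.support_reverse, List.mem_reverse] at hzP,
        by rwa [Walk.support_reverse, List.mem_reverse] at hzQ⟩
    · obtain ⟨z, hzP, hzQ⟩ := exists_mem_support_of_crossing P'.reverse Q'
        (fun z hz => hP'box z (by rwa [Walk.support_reverse, List.mem_reverse] at hz)) hQ'box hq' hp' hu' hv'
      exact ⟨z, by rwa [Walk.support_reverse, List.mem_reverse] at hzP, hzQ⟩
  obtain ⟨z, hzP', hzQ'⟩ := hmeet
  rcases hP' z hzP' with hzP | hzP <;> rcases hQ' z hzQ' with hzQ | hzQ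
  · exact ⟨z, hzP, hzQ⟩
  · exact ⟨z, hzP, h2 z hzQ (hP z hzP)⟩
  · exact ⟨z, h1 z hzP (hQ z hzQ), hzQ⟩
  · by_cases hb : L ≤ z 0 ∧ z 0 ≤ R ∧ B ≤ z 1 ∧ z 1 ≤ T
    · exact ⟨z, h1 z hzP hb, h2 z hzQ hb⟩
    · exact h3 z hzP hzQ (by omega)

/-- A point with the coordinates of the start of a walk is on the walk. [folklore] -/
theorem mem_support_of_eq_start {x y z : Site 2} (W : (zdGraph 2).Walk x y) (h0 : z 0 = x 0)
    (h1 : z 1 = x 1) : z ∈ W.support := by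
  obtain rfl : z = x := Site.eq_iff_two.2 ⟨h0, h1⟩
  exact W.start_mem_support

/-- A point with the coordinates of the end of a walk is on the walk. [folklore] -/
theorem mem_support_of_eq_end {x y z : Site 2} (W : (zdGraph 2).Walk x y) (h0 : z 0 = y 0)
    (h1 : z 1 = y 1) : z ∈ W.support := by
  obtain rfl : z = y := Site.eq_iff_two.2 ⟨h0, h1⟩
  exact W.end_mem_support

/-- Vertices of a doubly extended walk `A ++ P ++ E`. [folklore] -/
theorem mem_support_append3 {a b c d z : Site 2} {A : (zdGraph 2).Walk a b} {P : (zdGraph 2).Walk b c}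
    {E : (zdGraph 2).Walk c d} (hz : z ∈ (A.append (P.append E)).support) :
    z ∈ P.support ∨ (z ∈ A.support ∨ z ∈ E.support) := by
  rw [Walk.mem_support_append_iff, Walk.mem_support_append_iff] at hz
  tauto

/-! ### Walks from the top side to a vertical side -/

/-- **A walk from the top side to the left side crosses a top–bottom walk started to its left**
(`TopSideToLeftMeetsTB`). Extend `σ` by the hook `(R+1, T+1) → (s₀, T+1) → s` and the step
`f → (L-1, f₁)`, and `γ` by one step up at `g₁` and one step down at `g₂`; the extensions are a
left–right and a top–bottom crossing of `[L-1, R+1] × [B-1, T+1]`. [folklore] -/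
theorem topSideToLeftMeetsTB : TopSideToLeftMeetsTB := by
  intro L R B T g₁ g₂ s f γ σ hBT hγ hσ hg₁ hg₂ hs hsg hf
  obtain ⟨u', C, hu'0, hu'1, hC⟩ := exists_hookWalk_vh (g₁ 0) (T + 1) g₁
  obtain ⟨v', D, hv'0, hv'1, hD⟩ := exists_hookWalk_from_vh g₂ (g₂ 0) (B - 1)
  obtain ⟨s', A, hs'0, hs'1, hA⟩ := exists_hookWalk_hv (R + 1) (T + 1) s
  obtain ⟨f', E, hf'0, hf'1, hE⟩ := exists_hookWalk_from_hv f (L - 1) (f 1)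
  have hg₁b := hγ g₁ γ.start_mem_support
  have hg₂b := hγ g₂ γ.end_mem_support
  have hsb := hσ s σ.start_mem_support
  have hfb := hσ f σ.end_mem_support
  suffices key : ∃ z ∈ σ.support, z ∈ γ.support by
    obtain ⟨z, hzσ, hzγ⟩ := key; exact ⟨z, hzγ, hzσ⟩
  refine meet_of_extensions (L' := L - 1) (R' := R + 1) (B' := B - 1)
    (T' := T + 1) σ γ (A.append (σ.append E)) (C.append (γ.append D))
    (fun z => z ∈ A.support ∨ z ∈ E.support) (fun z => z ∈ C.support ∨ z ∈ D.support)
    hσ hγ (by omega) (fun z hz => mem_support_append3 hz) (fun z hz => mem_support_append3 hz)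
    ?_ ?_ ?_ ?_ ?_ (Or.inr ⟨by omega, by omega⟩) (Or.inl ⟨by omega, by omega⟩)
  · rintro z (hz | hz)
    · have := hA z hz; omega
    · have := hE z hz; omega
  · rintro z (hz | hz)
    · have := hC z hz; omega
    · have := hD z hz; omega
  · rintro z (hz | hz) hb
    · have := hA z hz
      exact mem_support_of_eq_start σ (by omega) (by omega)
    · have := hE z hz
      exact mem_support_of_eq_end σ (by omega) (by omega)
  · rintro z (hz | hz) hb
    · have := hC z hz
      exact mem_support_of_eq_start γ (by omega) (by omega)
    · have := hD z hz
      exact mem_support_of_eq_end γ (by omega) (by omega)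
  · rintro z (hz | hz) (hz' | hz') hb <;> exfalso
    · have := hA z hz; have := hC z hz'; omega
    · have := hA z hz; have := hD z hz'; omega
    · have := hE z hz; have := hC z hz'; omega
    · have := hE z hz; have := hD z hz'; omega

/-- Mirror image (`TopSideToRightMeetsTB`): `σ` starts strictly left of `γ`'s top endpoint and
reaches the right column; extend `σ` by `(L-1, T+1) → (s₀, T+1) → s` and `f → (R+1, f₁)`.
[folklore] -/
theorem topSideToRightMeetsTB : TopSideToRightMeetsTB := by
  intro L R B T g₁ g₂ s f γ σ hBT hγ hσ hg₁ hg₂ hs hsg hf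
  obtain ⟨u', C, hu'0, hu'1, hC⟩ := exists_hookWalk_vh (g₁ 0) (T + 1) g₁
  obtain ⟨v', D, hv'0, hv'1, hD⟩ := exists_hookWalk_from_vh g₂ (g₂ 0) (B - 1)
  obtain ⟨s', A, hs'0, hs'1, hA⟩ := exists_hookWalk_hv (L - 1) (T + 1) s
  obtain ⟨f', E, hf'0, hf'1, hE⟩ := exists_hookWalk_from_hv f (R + 1) (f 1)
  have hg₁b := hγ g₁ γ.start_mem_support
  have hg₂b := hγ g₂ γ.end_mem_support
  have hsb := hσ s σ.start_mem_support
  have hfb := hσ f σ.end_mem_support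
  suffices key : ∃ z ∈ σ.support, z ∈ γ.support by
    obtain ⟨z, hzσ, hzγ⟩ := key; exact ⟨z, hzγ, hzσ⟩
  refine meet_of_extensions (L' := L - 1) (R' := R + 1) (B' := B - 1)
    (T' := T + 1) σ γ (A.append (σ.append E)) (C.append (γ.append D))
    (fun z => z ∈ A.support ∨ z ∈ E.support) (fun z => z ∈ C.support ∨ z ∈ D.support)
    hσ hγ (by omega) (fun z hz => mem_support_append3 hz) (fun z hz => mem_support_append3 hz)
    ?_ ?_ ?_ ?_ ?_ (Or.inl ⟨by omega, by omega⟩) (Or.inl ⟨by omega, by omega⟩)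
  · rintro z (hz | hz)
    · have := hA z hz; omega
    · have := hE z hz; omega
  · rintro z (hz | hz)
    · have := hC z hz; omega
    · have := hD z hz; omega
  · rintro z (hz | hz) hb
    · have := hA z hz
      exact mem_support_of_eq_start σ (by omega) (by omega)
    · have := hE z hz
      exact mem_support_of_eq_end σ (by omega) (by omega)
  · rintro z (hz | hz) hb
    · have := hC z hz
      exact mem_support_of_eq_start γ (by omega) (by omega)
    · have := hD z hz
      exact mem_support_of_eq_end γ (by omega) (by omega)
  · rintro z (hz | hz) (hz' | hz') hb <;> exfalso
    · have := hA z hz; have := hC z hz'; omega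
    · have := hA z hz; have := hD z hz'; omega
    · have := hE z hz; have := hC z hz'; omega
    · have := hE z hz; have := hD z hz'; omega

/-! ### Discharges under the census names

The discharges of the named facts `TopSideToLeftMeetsTB` and `TopSideToRightMeetsTB` of
`KSTPeriodicStatements.lean` under the standard names `TopSideToLeftMeetsTB_holds` /
`TopSideToRightMeetsTB_holds` live in the discharge file `KSTPeriodicStatementsProofs.lean`
(the `<File>Proofs.lean` sibling of the statements file, where the debt census reads them); they
are the one-line aliases of `topSideToLeftMeetsTB` / `topSideToRightMeetsTB` above
(moved there 2026-08-16). -/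

end KSTPeriodic

end

end Literature.Probability.Percolation
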